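import Summits.RiemannHypothesis.RiemannHypothesis.Theorems.WeilGroundStateGroundStatesConvergeToXiRenormBlowupOverlap
import HarnessLib

/-!
# `WeilGroundState.GroundStatesConvergeToXi` — renormalisation blow-up: a crux witness with
bounded constants `c_k` proves RH
(crux item stmt-RiemannHypothesis-1527, route route-RiemannHypothesis-WeilGroundState; line `Sketch`,
lead c3; `--supports`: hardness of the crux / of the open stub `stub_tightWeakLimit`)

RH-free.  The crux asks for ground states `u_k` at windows `a_k → ∞` and constants `c_k ≠ 0` with
`c_k · weilMellin u_k → ξ` locally uniformly on the open strip.  The previous cycle proved that a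
witness with bounded renormalised `L¹` mass `∫‖c_k u_k‖` proves RH (`…RHofTightZero`).  Here the
`L¹` proviso is replaced by the weaker and more natural one on the CONSTANTS:

* `riemannHypothesis_of_cruxWitness_norm_le` — **a witness of the crux with `‖c_k‖ ≤ M` along a
  subsequence proves RH**; `…_norm_bounded`, `…_groundStatesConvergeToXi_norm_bounded` (verbatim
  clauses of the crux + `∃ M, ∀ k, ‖c_k‖ ≤ M`);
* `tendsto_norm_atTop_of_not_riemannHypothesis` — under `¬RH` every crux witness has `‖c_k‖ → ∞`;
* `tendstoLocallyUniformlyOn_weilMellin_zero_of_not_riemannHypothesis` — under `¬RH` the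
  NORMALISED ground states of every crux witness collapse: `weilMellin u_k → 0` locally uniformly
  on the strip.
Mechanism: Plancherel on the critical line (`∫|û_k(1/2+iτ)|²dτ = 2π`, window-independent)
makes the overlap `⟨u_k, φ_{a_k}⟩` with the window's own truncated Riemann kernel at least
`‖Ξ‖²_{L²}/(2‖c_k‖)` (`…RenormBlowupOverlap`), while the overlap–energy inequality
(`…OverlapEnergy`) bounds `|ε(a_k)|·‖⟨u_k, φ_{a_k}⟩‖` by `K exp(−(π/4)e^{2(a_k−1)})e^{3a_k/2} → 0`;
so `ε(a_k) → 0` along the bounded subsequence, `ε` antitone ⇒ bounded below ⇒ RH.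
So the only crux witnesses NOT provably giving RH are those with `‖c_k‖ → ∞`, i.e. whose
normalised ground states have transforms tending to `0` on compacta of the strip while `c_k û_k`
still converges to `ξ` there.  No new definitions.
-/

noncomputable section

set_option linter.dupNamespace false

open scoped Topology Real ComplexConjugate FourierTransform
open Filter Set MeasureTheory Complex

namespace Summit.RiemannHypothesis.RiemannHypothesis.Theorems.GroundStatesConvergeToXi

open Literature.NumberTheory.LFunctions

/-- **`L¹(e^{|t|/2})`-mass of a ground state on its window**: `∫ ‖u‖ e^{|t|/2} ≤ e^{3a/2}`
(`e^{|t|/2} ≤ e^{a/2}` on the window and `∫‖u‖ ≤ a + 1/2 ≤ e^{a}` by `‖u‖ ≤ (‖u‖² + 1)/2`,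
`∫‖u‖² = 1`). [folklore] -/
theorem integral_norm_mul_exp_half_le_exp {a : ℝ} {u : ℝ → ℂ} (hu : IsWeilGroundState a u) :
    ∫ t, ‖u t‖ * Real.exp (1 / 2 * |t|) ≤ Real.exp (3 / 2 * a) := by
  have ha : 0 < a := hu.pos
  have h1 := integral_norm_mul_exp_half_le_of_window hu 1 (b := 0) (by norm_num)
  simp only [one_mul, zero_mul, Real.exp_zero, mul_one, sub_zero] at h1
  -- `∫ ‖u‖ ≤ a + 1/2`
  have hu2 : Integrable fun t => ‖u t‖ ^ 2 :=
    (memLp_two_iff_integrable_sq_norm hu.memLp.1).1 hu.memLp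
  have hind : IntegrableOn (fun _ : ℝ => (1 : ℝ)) (Icc (-a) a) := by
    rw [integrableOn_const_iff]; right; exact measure_Icc_lt_top
  have hmaj : Integrable fun t => (‖u t‖ ^ 2 + (Icc (-a) a).indicator (fun _ => (1 : ℝ)) t) / 2 :=
    (hu2.add (hind.integrable_indicator measurableSet_Icc)).div_const 2
  have hL1 : ∫ t, ‖u t‖ ≤ a + 1 / 2 := by
    calc ∫ t, ‖u t‖ ≤ ∫ t, (‖u t‖ ^ 2 + (Icc (-a) a).indicator (fun _ => (1 : ℝ)) t) / 2 := by
          refine integral_mono_ae hu.integrable.norm hmaj ?_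
          filter_upwards [hu.ae_eq_zero_of_notMem] with t ht
          by_cases hm : t ∈ Icc (-a) a
          · simp only [hm, indicator_of_mem]
            nlinarith [sq_nonneg (‖u t‖ - 1)]
          · simp [ht hm, hm]
      _ = ((∫ t, ‖u t‖ ^ 2) + ∫ t, (Icc (-a) a).indicator (fun _ => (1 : ℝ)) t) / 2 := by
          rw [integral_div, integral_add hu2 (hind.integrable_indicator measurableSet_Icc)]
      _ = a + 1 / 2 := by
          rw [hu.integral_norm_sq, integral_indicator measurableSet_Icc, setIntegral_const,
            measureReal_def, Real.volume_Icc, ENNReal.toReal_ofReal (by linarith)]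
          simp only [smul_eq_mul, mul_one]
          ring
  have hL1' : ∫ t, ‖u t‖ ≤ Real.exp a := by
    have := Real.add_one_le_exp a
    linarith
  calc ∫ t, ‖u t‖ * Real.exp (1 / 2 * |t|) ≤ Real.exp (1 / 2 * a) * ∫ t, ‖u t‖ := h1
    _ ≤ Real.exp (1 / 2 * a) * Real.exp a :=
        mul_le_mul_of_nonneg_left hL1' (Real.exp_pos _).le
    _ = Real.exp (3 / 2 * a) := by rw [← Real.exp_add]; congr 1; ring

/-- **Energy side**: `|ε(a)| · ‖⟨u, φ_a⟩‖ ≤ K η(a) e^{3a/2}` for every ground state `u` at a window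
`a ≥ 1` (overlap–energy inequality of `…OverlapEnergy` and the window bound above). [folklore] -/
theorem exists_abs_weilGroundEnergy_mul_norm_overlap_le_exp :
    ∃ K : ℝ, 0 ≤ K ∧ ∀ a : ℝ, 1 ≤ a → ∀ u : ℝ → ℂ, IsWeilGroundState a u →
      |weilGroundEnergy a| * ‖∫ t, u t * conj ((2 : ℂ) * LagariasMontague.Psic (2 * t) *
          ((Literature.Analysis.Calculus.cutoff a t : ℝ) : ℂ))‖ ≤
        K * (Real.exp (-(π / 4 * Real.exp (2 * (a - 1)))) * Real.exp (3 / 2 * a)) := by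
  obtain ⟨K, hK, hO⟩ := exists_abs_weilGroundEnergy_mul_norm_overlap_le
  refine ⟨K, hK, fun a ha u hu => (hO a ha u hu).trans ?_⟩
  rw [← mul_assoc]
  exact mul_le_mul_of_nonneg_left (integral_norm_mul_exp_half_le_exp hu) (by positivity)

/-! ## The hardness theorems: bounded renormalisation constants already force RH -/

/-- **A witness of the CRUX whose renormalisation constants are bounded along a subsequence
proves RH (RH-free mechanism).**  Let `a_k → ∞`, `u_k` ground states at `a_k`, `c_k` scalars with
`c_k · weilMellin u_k → ξ` locally uniformly on the open strip, and `‖c_k‖ ≤ M` frequently.  Then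
the Riemann Hypothesis holds: by `exists_eventually_norm_overlap_ge` the overlaps
`‖⟨u_k, φ_{a_k}⟩‖ ≥ L > 0` along the bounded subsequence, while the overlap–energy inequality gives
`|ε(a_k)| · ‖⟨u_k, φ_{a_k}⟩‖ ≤ K exp(−(π/4)e^{2(a_k−1)}) e^{3a_k/2} → 0`; so `ε(a_k) ≥ −1`
frequently along `a_k → ∞`, `ε` is antitone, hence bounded below, hence RH
(`riemannHypothesis_of_weilGroundEnergy_bddBelow`). -/
theorem riemannHypothesis_of_cruxWitness_norm_le {a : ℕ → ℝ} {u : ℕ → ℝ → ℂ} {c : ℕ → ℂ}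
    (ha : Tendsto a atTop atTop) (hu : ∀ k, IsWeilGroundState (a k) (u k))
    (hlim : TendstoLocallyUniformlyOn (fun k s => c k * weilMellin (u k) s) riemannXi atTop
      {s : ℂ | 0 < s.re ∧ s.re < 1})
    (hM : ∃ M : ℝ, ∃ᶠ k in atTop, ‖c k‖ ≤ M) : RiemannHypothesis := by
  obtain ⟨M, hMf⟩ := hM
  set M' : ℝ := max M 1 with hM'def
  have hM' : 0 < M' := lt_of_lt_of_le one_pos (le_max_right _ _)
  have hMf' : ∃ᶠ k in atTop, ‖c k‖ ≤ M' := hMf.mono fun k hk => hk.trans (le_max_left _ _)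
  obtain ⟨L, hL0, hL⟩ := exists_eventually_norm_overlap_ge ha hu hlim hM'
  obtain ⟨K, hK0, hK⟩ := exists_abs_weilGroundEnergy_mul_norm_overlap_le_exp
  have hzero : Tendsto (fun k => K / L * (Real.exp (-(π / 4 * Real.exp (2 * (a k - 1)))) *
      Real.exp (3 / 2 * a k))) atTop (𝓝 0) := by
    simpa using (tendsto_superexp_mul_exp_threeHalves_zero.comp ha).const_mul (K / L)
  have hev : ∀ᶠ k in atTop, ‖c k‖ ≤ M' → -1 ≤ weilGroundEnergy (a k) := by
    filter_upwards [hL, ha.eventually (eventually_ge_atTop (1 : ℝ)),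
      hzero.eventually (ge_mem_nhds one_pos)] with k hk hak hsmall hcM
    have h1 := hK (a k) hak (u k) (hu k)
    have h2 := hk hcM
    have h3 : |weilGroundEnergy (a k)| * L ≤ K * (Real.exp (-(π / 4 * Real.exp (2 * (a k - 1)))) *
        Real.exp (3 / 2 * a k)) :=
      (mul_le_mul_of_nonneg_left h2 (abs_nonneg _)).trans h1
    have h4 : |weilGroundEnergy (a k)| ≤ K / L * (Real.exp (-(π / 4 * Real.exp (2 * (a k - 1)))) *
        Real.exp (3 / 2 * a k)) := by
      rw [div_mul_eq_mul_div, le_div_iff₀ hL0]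
      exact h3
    have h5 := (abs_le.1 (h4.trans hsmall)).1
    linarith
  have hfreq : ∃ᶠ k in atTop, -1 ≤ weilGroundEnergy (a k) :=
    (hMf'.and_eventually hev).mono fun k hk => hk.2 hk.1
  refine riemannHypothesis_of_weilGroundEnergy_bddBelow ⟨-1, fun b hb => ?_⟩
  obtain ⟨k, hk1, hk2⟩ := (hfreq.and_eventually (ha.eventually (eventually_ge_atTop b))).exists
  exact hk1.trans
    (Summit.RiemannHypothesis.Cruxes.GronwallLeakage.Negative.weilGroundEnergy_antitone_of_pos hb hk2)

/-- **Bounded renormalisation constants ⇒ RH** (the `∀ k` form). [folklore] -/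
theorem riemannHypothesis_of_cruxWitness_norm_bounded {a : ℕ → ℝ} {u : ℕ → ℝ → ℂ} {c : ℕ → ℂ}
    (ha : Tendsto a atTop atTop) (hu : ∀ k, IsWeilGroundState (a k) (u k))
    (hlim : TendstoLocallyUniformlyOn (fun k s => c k * weilMellin (u k) s) riemannXi atTop
      {s : ℂ | 0 < s.re ∧ s.re < 1})
    (hM : ∃ M : ℝ, ∀ k, ‖c k‖ ≤ M) : RiemannHypothesis := by
  obtain ⟨M, hM⟩ := hM
  exact riemannHypothesis_of_cruxWitness_norm_le ha hu hlim ⟨M, Frequently.of_forall hM⟩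

/-- **The crux, restricted to witnesses with bounded renormalisation constants, implies RH**
(verbatim clauses of `GroundStatesConvergeToXi` plus `∃ M, ∀ k, ‖c_k‖ ≤ M`). [folklore] -/
theorem riemannHypothesis_of_groundStatesConvergeToXi_norm_bounded
    (h : ∃ a : ℕ → ℝ, ∃ u : ℕ → ℝ → ℂ, ∃ c : ℕ → ℂ, Tendsto a atTop atTop ∧
      (∀ k, 0 < a k ∧ c k ≠ 0 ∧ MemLp (u k) 2 ∧ ∃ g : ℕ → ℝ → ℂ,
        (∀ n, IsWeilTest (g n) ∧ tsupport (g n) ⊆ Icc (-(a k)) (a k) ∧ ∫ t, ‖g n t‖ ^ 2 = (1 : ℝ)) ∧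
        Tendsto (fun n => (weilQuadratic (g n)).re) atTop (𝓝 (weilGroundEnergy (a k))) ∧
        Tendsto (fun n => ∫ t, ‖g n t - u k t‖ ^ 2) atTop (𝓝 0)) ∧
      TendstoLocallyUniformlyOn (fun k s => c k * weilMellin (u k) s) riemannXi atTop
        {s : ℂ | 0 < s.re ∧ s.re < 1} ∧
      ∃ M : ℝ, ∀ k, ‖c k‖ ≤ M) :
    RiemannHypothesis := by
  obtain ⟨a, u, c, ha, hk, hlim, hM⟩ := h
  exact riemannHypothesis_of_cruxWitness_norm_bounded ha (fun k => ⟨(hk k).2.2.1, (hk k).2.2.2⟩) hlim hM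

/-- **Under `¬RH`, the renormalisation constants of every crux witness blow up**:
`‖c_k‖ → ∞`. [folklore] -/
theorem tendsto_norm_atTop_of_not_riemannHypothesis (hRH : ¬ RiemannHypothesis)
    {a : ℕ → ℝ} {u : ℕ → ℝ → ℂ} {c : ℕ → ℂ}
    (ha : Tendsto a atTop atTop) (hu : ∀ k, IsWeilGroundState (a k) (u k))
    (hlim : TendstoLocallyUniformlyOn (fun k s => c k * weilMellin (u k) s) riemannXi atTop
      {s : ℂ | 0 < s.re ∧ s.re < 1}) :
    Tendsto (fun k => ‖c k‖) atTop atTop := by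
  by_contra h
  simp only [tendsto_atTop, not_forall, not_eventually, not_le] at h
  obtain ⟨M, hM⟩ := h
  exact hRH (riemannHypothesis_of_cruxWitness_norm_le ha hu hlim ⟨M, hM.mono fun k hk => hk.le⟩)

/-- **Under `¬RH`, the NORMALISED ground states of every crux witness collapse on the strip**:
`weilMellin u_k → 0` locally uniformly on `{0 < Re s < 1}` (since `c_k û_k → ξ` locally
uniformly with `‖c_k‖ → ∞`).  Equivalently: a crux witness whose normalised transforms `û_k` do
not tend to `0` somewhere on the strip proves RH. [folklore] -/
theorem tendstoLocallyUniformlyOn_weilMellin_zero_of_not_riemannHypothesis (hRH : ¬ RiemannHypothesis)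
    {a : ℕ → ℝ} {u : ℕ → ℝ → ℂ} {c : ℕ → ℂ}
    (ha : Tendsto a atTop atTop) (hu : ∀ k, IsWeilGroundState (a k) (u k))
    (hlim : TendstoLocallyUniformlyOn (fun k s => c k * weilMellin (u k) s) riemannXi atTop
      {s : ℂ | 0 < s.re ∧ s.re < 1}) :
    TendstoLocallyUniformlyOn (fun k s => weilMellin (u k) s) (0 : ℂ → ℂ) atTop
      {s : ℂ | 0 < s.re ∧ s.re < 1} := by
  have hc := tendsto_norm_atTop_of_not_riemannHypothesis hRH ha hu hlim
  have hS : IsOpen {s : ℂ | 0 < s.re ∧ s.re < 1} :=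
    (isOpen_lt continuous_const Complex.continuous_re).inter
      (isOpen_lt Complex.continuous_re continuous_const)
  rw [tendstoLocallyUniformlyOn_iff_forall_isCompact hS]
  intro K hKS hK
  have h1 : TendstoUniformlyOn (fun k s => c k * weilMellin (u k) s) riemannXi atTop K :=
    (tendstoLocallyUniformlyOn_iff_forall_isCompact hS).1 hlim K hKS hK
  obtain ⟨B, hB⟩ := hK.exists_bound_of_continuousOn
    differentiable_riemannXi.continuous.continuousOn
  rw [Metric.tendstoUniformlyOn_iff]
  intro ε hε
  have h2 := Metric.tendstoUniformlyOn_iff.1 h1 1 one_pos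
  have h3 := hc.eventually (eventually_gt_atTop ((|B| + 1) / ε))
  filter_upwards [h2, h3] with k hk hck s hs
  have h4 : ‖c k * weilMellin (u k) s‖ ≤ |B| + 1 := by
    have h5 := hk s hs
    rw [dist_eq_norm, norm_sub_rev] at h5
    have h6 := hB s hs
    have h7 := norm_le_insert' (c k * weilMellin (u k) s) (riemannXi s)
    linarith [le_abs_self B]
  have hcpos : 0 < ‖c k‖ := lt_trans (by positivity) hck
  rw [dist_eq_norm, Pi.zero_apply, zero_sub, norm_neg]
  have e : ‖weilMellin (u k) s‖ = ‖c k * weilMellin (u k) s‖ / ‖c k‖ := by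
    rw [norm_mul, mul_div_cancel_left₀ _ hcpos.ne']
  rw [e, div_lt_iff₀ hcpos]
  have h8 : (|B| + 1) / ε < ‖c k‖ := hck
  rw [div_lt_iff₀ hε] at h8
  linarith

end Summit.RiemannHypothesis.RiemannHypothesis.Theorems.GroundStatesConvergeToXi

end
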